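import Literature.NumberTheory.ComplexMultiplication.CMLatticeRingClassTowerGaloisDegrees
import Literature.NumberTheory.EllipticCurves.RingClassGalOverCardinality
import Literature.NumberTheory.EllipticCurves.JZeroKolyvaginPrimes
import HarnessLib

/-!
# Degrees in Hu–Shu–Yin's Sylvester tower `K[9m] ⊋ K[3m] ⊋ K[m]` over `K = ℚ(ω)` (`3 ∤ m`, `m ≥ 2`):
# `[K[9m] : K[m]] = 9`, `[K[3m] : K[m]] = 3`, `[K[9m] : K[3m]] = 3`, and the same numbers as the orders of
# `Gal(K[9m]/K[m])`, `Gal(K[3m]/K[m])`, `Gal(K[9m]/K[3m])` — hence the inertia group at `w = (1 − ω)` of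
# `Gal(K[9m]/K)` (= `Gal(K[9m]/K[m])`, `RingClassFieldInertiaGenerator` §5) has order `9` and `#D_w = 18`

Topic `NumberTheory/EllipticCurves/HuShuYin2019` (vocabulary of `HeegnerPointsOfConductor.lean`: the concrete ring
class field `K[n] = ringClassField K ι n ⊂ ℂ`, `ringClassGalOver ι n m = Gal(K[n]/K[n] ∩ K[m]) ≤ Aut_ℚ K[n]`; of
`RingClassFieldTower.lean`: `RingClassField.subfieldIn ι n m = K[n] ∩ K[m]` and the degree
`finrank (subfieldIn ι n m) K[n] = [K[n] : K[m]]`; of `ComplexMultiplication/CMLatticeRingClassTowerGaloisDegrees.lean`: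
COROLLARY 7.28 as field degrees, `natCast_finrank_subfieldIn_eq_prod`).  Companion of
`SylvesterTowerFrobeniusAtThree.lean` (the Frobenius half of `D_w`: `f_w(K[m]/K) = 2`, the involution) and of
`RingClassFieldInertiaGenerator.lean` §5 (inertia above `w` SURJECTS onto `Gal(K[9m]/K[m])` and fixes `K[m]`).
THEOREMS ONLY (no definition, no named fact, no instance, no `sorry`; D-0026, net debt 0); the Galois-correspondence
count `#ringClassGalOver ι n m = [K[n] : K[n] ∩ K[m]]` is imported from `RingClassGalOverCardinality.lean` (its public
Literature home; the first version of this file carried private copies).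
Seat `bsd-cm-k-ty1` (cell bsd-cm, crux `UpperOffV0HSYPlus`), planner WANT (W2-d)-(β)(i): serves the DISCHARGE of
the local conjunct at `w ∣ 3` of leaf (L1) at `p ≡ 7 (9)` (the order of the inertia part of `D_w ≤ Gal(K[9m]/K)`
behind the open subgroup `Φ ≤ Γ_{K_w}` of `KolyvaginClassLocalConditionCoprimeIndex` §5); NOT consumed by the rows'
chain at the level, which DISPLAYS that conjunct.  No summit statement is proved or advanced by this file alone.

## THE PRINT

Hu–Shu–Yin [HuShuYin2019] Prop. 2.4 (1) (PDF pp. 6–7): «`H_{9p} = H_{3p}(∛3)` with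
`Gal(H_{9p}/H_{3p}) = ⟨σ_{1+3ω₃}⟩ ≃ ℤ/3ℤ`», and the field diagram of §2.2 (PDF p. 7): `H_{9p} —3— H_{3p}`,
`H_{3p} —(p−1)/3— L_{(p)} = K(∛p) —3— K —2— ℚ` (`H_c` = the ring class field of conductor `c` over `K = ℚ(√−3)`,
`p ≡ 4, 7 (mod 9)`).  Cox [Cox2013] Thm. 7.24 (PDF p. 159): «`h(𝒪) = h(𝒪_K) f / [𝒪_K^* : 𝒪^*] · ∏_{p ∣ f}
(1 − (d_K/p)/p)`»; Cor. 7.28 (PDF p. 161): «`h(m²D) = h(D) m / [𝒪^* : 𝒪'^*] · ∏_{p ∣ m} (1 − (D/p)/p)`»; §9.A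
(9.1) (PDF pp. 192–193): «`C(𝒪) ≃ I_K(f)/P_{K,ℤ}(f) ≃ Gal(L/K)` … `[L : K] = h(𝒪)`».  At `K = ℚ(√−3)`,
`d_K = −3`, conductors `m` and `9m` with `3 ∤ m`, `m ≥ 2` (so both unit indices are `[𝒪_K^* : 𝒪^*] = 3` and
cancel): `[K[9m] : K[m]] = h(𝒪_{9m})/h(𝒪_m) = 9 · (1 − (−3/3)/3) = 9`; the two layers `[K[3m] : K[m]] =
3 − (−3/3) = 3` (ramified step) and `[K[9m] : K[3m]] = 3` (`3 ∣ 3m`).  Gross [GrossLMS1991] §3 (PDF p. 217):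
«`G_ℓ` is the subgroup fixing the subfield `K_{n/ℓ}`» (the Galois correspondence count `#Gal = degree`).

## WHAT IS FORMALISED (`K : Type` with `ω² + ω + 1 = 0`, `[K:ℚ] = 2`; `ι : K → ℂ`; `3 ∤ m`, `2 ≤ m`)

* §1 degrees: `JZero.finrank_subfieldIn_nine_mul` — **`[K[9m] : K[m]] = 9`**; `JZero.finrank_ringClassField_nine_mul`
  — `[K[9m] : K] = 9 [K[m] : K]`; `JZero.finrank_subfieldIn_three_mul` — `[K[3m] : K[m]] = 3`;
  `JZero.finrank_subfieldIn_nine_mul_three_mul` — `[K[9m] : K[3m]] = 3` (any `m ≥ 1`).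
* §2 groups: `JZero.card_ringClassGalOver_nine_mul` — **`#ringClassGalOver ι (9m) m = 9`**;
  `JZero.card_ringClassGalOver_three_mul` — `#ringClassGalOver ι (3m) m = 3`;
  `JZero.card_ringClassGalOver_nine_mul_three_mul` — `#ringClassGalOver ι (9m) (3m) = 3`.

With `RingClassFieldInertiaGenerator` §5 (`I_𝔚 ↠ ringClassGalOver ι (9m) m` along any `K`-embedding
`K[9m] → K̄`, inertia trivial on `K[m]`) and `SylvesterTowerFrobeniusAtThree` (`f_w(K[m]/K) = 2`): the image of the
decomposition group `D_𝔚 ≤ Γ_K` in `Gal(K[9m]/K)` has order `18 = 9 · 2`.  NOT HERE: that packaging (the rows read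
the three files separately); the STRUCTURE `Gal(K[9m]/K[m]) ≃ (ℤ/3)²` (not cyclic at `K = ℚ(√−3)`:
`CMTypeLattice.not_isCyclic_ker_restrict_dvd_three_pow_mul_of_discr_eq`); anything about elliptic curves.

## References

* Y. Hu, J. Shu, H. Yin, *An explicit Gross–Zagier formula related to the Sylvester conjecture*, Trans. AMS 372
  (2019), arXiv:1708.05266, §2.2 Prop. 2.4 (1) and the field diagram. [HuShuYin2019]
* D. A. Cox, *Primes of the form x² + ny²*, 2nd ed., Wiley 2013: §7.D Thm. 7.24, Cor. 7.28; §9.A (9.1). [Cox2013]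
* B. H. Gross, *Kolyvagin's work on modular elliptic curves*, LMS LNS 153 (1991), §3. [GrossLMS1991]

## Mathlib / tree search

Tree: `CMTypeLattice.natCast_finrank_subfieldIn_eq_prod`, `finrank_subfieldIn_prime_mul_of_dvd_discr`,
`finrank_subfieldIn_prime_mul_of_dvd`, `RingClassField.finrank_subfieldIn_mul_finrank`,
`JZero.discr_eq_neg_three_of_sq_add_self_add_one`, `JZero.isImaginaryQuadratic_of_sq_add_self_add_one`,
`RingClassField.card_ringClassGalOver_eq_finrank_subfieldIn` (`RingClassGalOverCardinality.lean`).  Mathlib: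
`Nat.primeFactors_prime_pow`, `Nat.Prime.factorization_pow`, `jacobiSym.mod_left`, `jacobiSym.zero_left`.
-/

noncomputable section

open scoped Classical NumberField
open NumberField Module Field

namespace Literature.NumberTheory.EllipticCurves.HuShuYin2019

open Literature.NumberTheory.EllipticCurves Literature.NumberTheory.EllipticCurves.RingClassField
open Literature.NumberTheory.ComplexMultiplication Literature.NumberTheory.ComplexMultiplication.CMTypeLattice

variable {K : Type} [Field K] [NumberField K] {ω : K}

/-! ## §1 `[K[9m] : K[m]] = 9`, `[K[3m] : K[m]] = 3`, `[K[9m] : K[3m]] = 3` for `K = ℚ(ω)`, `3 ∤ m`, `m ≥ 2` -/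

/-- **`[K[9m] : K[m]] = 9`** for `K = ℚ(ω)`, `3 ∤ m`, `m ≥ 2` (COR. 7.28 at `d_K = −3`: `9·(1 − (−3/3)/3) = 9`).
[cite: Cox2013, §7.D Thm. 7.24 and Cor. 7.28 (PDF pp. 159, 161); §9.A (9.1) (PDF pp. 192–193)]
[cite: HuShuYin2019, §2.2 Prop. 2.4 (1) and field diagram (PDF pp. 6–7: H_{9p} —3— H_{3p})] -/
theorem JZero.finrank_subfieldIn_nine_mul (hω : ω ^ 2 + ω + 1 = 0) (h2 : finrank ℚ K = 2) (ι : K →+* ℂ)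
    {m : ℕ} (hm3 : ¬ 3 ∣ m) (hm : 2 ≤ m) :
    finrank (subfieldIn ι (9 * m) m) (ringClassField K ι (9 * m)) = 9 := by
  have hK := JZero.isImaginaryQuadratic_of_sq_add_self_add_one hω h2
  have h := natCast_finrank_subfieldIn_eq_prod hK ι (by norm_num : (9 : ℕ) ≠ 0) hm
  have hpf : (9 : ℕ).primeFactors = {3} := by
    rw [show (9 : ℕ) = 3 ^ 2 by norm_num, Nat.primeFactors_prime_pow two_ne_zero Nat.prime_three]
  have hfac : (9 : ℕ).factorization 3 = 2 := by
    rw [show (9 : ℕ) = 3 ^ 2 by norm_num, Nat.Prime.factorization_pow Nat.prime_three, Finsupp.single_eq_same]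
  have hj : jacobiSym (-3) 3 = 0 := by
    rw [jacobiSym.mod_left, show (-3 : ℤ) % ((3 : ℕ) : ℤ) = 0 by norm_num]
    exact jacobiSym.zero_left (by norm_num)
  rw [hpf, Finset.prod_singleton, hfac, if_neg hm3, if_neg (by norm_num : (3 : ℕ) ≠ 2),
    JZero.discr_eq_neg_three_of_sq_add_self_add_one hω h2, hj] at h
  norm_num at h
  exact_mod_cast h

/-- `[K[9m] : K] = 9 · [K[m] : K]` (`3 ∤ m`, `m ≥ 2`): `h(𝒪_{9m}) = 9 h(𝒪_m)` at `K = ℚ(√−3)`.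
[cite: Cox2013, §7.D Cor. 7.28 (PDF p. 161); §9.A (PDF p. 193: [L : K] = h(𝒪))] -/
theorem JZero.finrank_ringClassField_nine_mul (hω : ω ^ 2 + ω + 1 = 0) (h2 : finrank ℚ K = 2)
    (ι : K →+* ℂ) {m : ℕ} (hm3 : ¬ 3 ∣ m) (hm : 2 ≤ m) :
    finrank K (ringClassField K ι (9 * m)) = 9 * finrank K (ringClassField K ι m) := by
  have hK := JZero.isImaginaryQuadratic_of_sq_add_self_add_one hω h2
  rw [← finrank_subfieldIn_mul_finrank hK ι (dvd_mul_left m 9) (by omega),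
    JZero.finrank_subfieldIn_nine_mul hω h2 ι hm3 hm]

/-- `[K[3m] : K[m]] = 3` (`3 ∤ m`, `m ≥ 2`): the RAMIFIED step, `3 − (d_K/3) = 3` as `3 ∣ d_K = −3`.
[cite: Cox2013, §7.D Cor. 7.28 (PDF p. 161)] [cite: HuShuYin2019, §2.2 field diagram (PDF p. 7)] -/
theorem JZero.finrank_subfieldIn_three_mul (hω : ω ^ 2 + ω + 1 = 0) (h2 : finrank ℚ K = 2) (ι : K →+* ℂ)
    {m : ℕ} (hm3 : ¬ 3 ∣ m) (hm : 2 ≤ m) :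
    finrank (subfieldIn ι (3 * m) m) (ringClassField K ι (3 * m)) = 3 := by
  have hK := JZero.isImaginaryQuadratic_of_sq_add_self_add_one hω h2
  refine finrank_subfieldIn_prime_mul_of_dvd_discr hK ι Nat.prime_three ?_
    ((Nat.Prime.coprime_iff_not_dvd Nat.prime_three).mpr hm3) (Or.inl hm)
  rw [JZero.discr_eq_neg_three_of_sq_add_self_add_one hω h2]; norm_num

/-- `[K[9m] : K[3m]] = 3` (any `m ≥ 1`): the step at a prime dividing the conductor.
[cite: HuShuYin2019, §2.2 Prop. 2.4 (1) (PDF pp. 6–7: Gal(H_{9p}/H_{3p}) ≃ ℤ/3ℤ)] [cite: Cox2013, §7.D Cor. 7.28 (PDF p. 161)] -/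
theorem JZero.finrank_subfieldIn_nine_mul_three_mul (hω : ω ^ 2 + ω + 1 = 0) (h2 : finrank ℚ K = 2)
    (ι : K →+* ℂ) {m : ℕ} (hm0 : m ≠ 0) :
    finrank (subfieldIn ι (9 * m) (3 * m)) (ringClassField K ι (9 * m)) = 3 := by
  have hK := JZero.isImaginaryQuadratic_of_sq_add_self_add_one hω h2
  rw [show 9 * m = 3 * (3 * m) by ring]
  exact finrank_subfieldIn_prime_mul_of_dvd hK ι Nat.prime_three (dvd_mul_right 3 m) (by omega)

/-! ## §2 The group: `#Gal(K[9m]/K[m]) = #ringClassGalOver ι (9m) m = 9` -/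

/-- **`#Gal(K[9m]/K[m]) = #ringClassGalOver ι (9m) m = 9`** (`K = ℚ(ω)`, `3 ∤ m`, `m ≥ 2`) — the order of the
inertia group at `w = (1 − ω)` of `Gal(K[9m]/K)` (`RingClassFieldInertiaGenerator` §5).
[cite: Cox2013, §7.D Cor. 7.28, §9.A (9.1) (PDF pp. 161, 192–193)] [cite: GrossLMS1991, §3 (PDF p. 217: G_ℓ fixes K_{n/ℓ})]
[cite: HuShuYin2019, §2.2 Prop. 2.4 (1) and field diagram (PDF pp. 6–7)] -/
theorem JZero.card_ringClassGalOver_nine_mul (hω : ω ^ 2 + ω + 1 = 0) (h2 : finrank ℚ K = 2)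
    (ι : K →+* ℂ) {m : ℕ} (hm3 : ¬ 3 ∣ m) (hm : 2 ≤ m) :
    Nat.card (ringClassGalOver ι (9 * m) m) = 9 := by
  rw [card_ringClassGalOver_eq_finrank_subfieldIn (JZero.isImaginaryQuadratic_of_sq_add_self_add_one hω h2)
    ι m (by omega)]
  exact JZero.finrank_subfieldIn_nine_mul hω h2 ι hm3 hm

/-- `#ringClassGalOver ι (3m) m = 3` (`3 ∤ m`, `m ≥ 2`). [cite: Cox2013, §7.D Cor. 7.28 (PDF p. 161), §9.A (9.1)]
[cite: HuShuYin2019, §2.2 field diagram (PDF p. 7)] -/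
theorem JZero.card_ringClassGalOver_three_mul (hω : ω ^ 2 + ω + 1 = 0) (h2 : finrank ℚ K = 2)
    (ι : K →+* ℂ) {m : ℕ} (hm3 : ¬ 3 ∣ m) (hm : 2 ≤ m) :
    Nat.card (ringClassGalOver ι (3 * m) m) = 3 := by
  rw [card_ringClassGalOver_eq_finrank_subfieldIn (JZero.isImaginaryQuadratic_of_sq_add_self_add_one hω h2)
    ι m (by omega)]
  exact JZero.finrank_subfieldIn_three_mul hω h2 ι hm3 hm

/-- `#ringClassGalOver ι (9m) (3m) = 3` (any `m ≥ 1`): Hu–Shu–Yin's `Gal(H_{9p}/H_{3p}) ≃ ℤ/3ℤ`.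
[cite: HuShuYin2019, §2.2 Prop. 2.4 (1) (PDF pp. 6–7)] [cite: Cox2013, §7.D Cor. 7.28 (PDF p. 161), §9.A (9.1)] -/
theorem JZero.card_ringClassGalOver_nine_mul_three_mul (hω : ω ^ 2 + ω + 1 = 0) (h2 : finrank ℚ K = 2)
    (ι : K →+* ℂ) {m : ℕ} (hm0 : m ≠ 0) :
    Nat.card (ringClassGalOver ι (9 * m) (3 * m)) = 3 := by
  rw [card_ringClassGalOver_eq_finrank_subfieldIn (JZero.isImaginaryQuadratic_of_sq_add_self_add_one hω h2)
    ι (3 * m) (by omega)]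
  exact JZero.finrank_subfieldIn_nine_mul_three_mul hω h2 ι hm0

end Literature.NumberTheory.EllipticCurves.HuShuYin2019
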